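import Summits.CriticalPhenomena.SAWScalingLimit.Theses.SAWDevelopingMap
import Summits.CriticalPhenomena.SAWScalingLimit.Theorems.SAWDevelopingMapPotentialExists
import HarnessLib

/-!
# Crux `BoundaryClosureR`, line `pick-half-plane` — stub `stub_potentialExistence`

Stub (E1) of the line `pick-half-plane` of the crux `SAWDefectDecoherence.BoundaryClosureR`
(stmt-CriticalPhenomena-14004): **existence of the developing map** `H` of `F dz`.  For every
simply connected hexagonal domain `Λ` (`hexDomainSimplyConnected Λ`, connected complement) and
every boundary mid-edge `a` there is `H : Site 2 → ℂ` on the hexagon centres (= vertices of the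
triangular lattice `𝕋`) such that for every `v ∈ Λ`, every neighbour `w` of `v` and the common
`𝕋`-edge `{s, t} = hexFaceVertices v ∩ hexFaceVertices w`, oriented with the centre of `v` on
its LEFT (`0 < Im (conj (t - s) · (c_v - s))`),
`H t - H s = (hexMidpoint {v, w} - hexCenter v) · F({v, w})`,
`F = hexParafermionicObservable Λ a x_c (5/8)`.

The statement below is, word for word, the body of the line-local abbreviation
`PickHalfPlane.PotentialExistence` (with `IsPotential` unfolded), which in turn is VERBATIM the
pool item `Summit.CriticalPhenomena.SAWScalingLimit.Theses.SAWDevelopingMap.PotentialExists`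
(stmt-CriticalPhenomena-8299).  That item is proved in the tree:
`Summit.CriticalPhenomena.SAWScalingLimit.Theorems.potentialExists_proof`
(`Theorems/SAWDevelopingMapPotentialExists.lean`; closedness on each triangle = Duminil-Copin–Smirnov
Lemma 1, `DuminilCopinSmirnov2012_lemma1_holds`; exactness = the discrete Poincaré lemma
`PotentialExists.exists_potential` on the union of the closed triangles of `Λ`, whose complement is
connected).  This file serves the stub by that theorem (the two types agree by unfolding the
route-level `def`).

No new definitions; every declaration is proved; no named-fact hypotheses.
-/

namespace Summit.CriticalPhenomena.SAWScalingLimit.Theorems.PickHalfPlane.Potential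

open Literature.Probability.LatticeModels Literature.Probability.RandomPlanarGeometry.SAW

/-- **Stub `stub_potentialExistence` (line `pick-half-plane`, crux `BoundaryClosureR`,
stmt-CriticalPhenomena-14004): the developing map exists.**  For every simply connected `Λ` and
boundary mid-edge `a` there is a potential `H : Site 2 → ℂ` of `F dz`:
`H t - H s = (hexMidpoint {v, w} - hexCenter v) · F_{x_c, 5/8}({v, w})` along every `𝕋`-edge
`s → t` dual to `{v, w}`, `v ∈ Λ`, with the centre of `v` on its left.  This is the pool item
`SAWDevelopingMap.PotentialExists` (stmt-CriticalPhenomena-8299), spelled out, and it is proved in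
the tree by `Theorems.potentialExists_proof` (DCS Lemma 1 + discrete Poincaré lemma). -/
theorem stub_potentialExistence :
    ∀ (Λ : Finset HexVertex), hexDomainSimplyConnected Λ → ∀ a ∈ hexDomainBoundary Λ,
      ∃ H : Site 2 → ℂ, ∀ v ∈ Λ, ∀ w : HexVertex, hexGraph.Adj v w → ∀ s t : Site 2,
        s ∈ hexFaceVertices v → t ∈ hexFaceVertices v → s ∈ hexFaceVertices w →
        t ∈ hexFaceVertices w → s ≠ t →
        0 < ((starRingEnd ℂ) (triEmbed t - triEmbed s) * (hexCenter v - triEmbed s)).im →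
        H t - H s = (hexMidpoint s(v, w) - hexCenter v) *
          hexParafermionicObservable Λ a hexCriticalFugacity (5 / 8) s(v, w) :=
  Summit.CriticalPhenomena.SAWScalingLimit.Theorems.potentialExists_proof

end Summit.CriticalPhenomena.SAWScalingLimit.Theorems.PickHalfPlane.Potential
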